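import Mathlib
import Literature.RepresentationTheory.FiniteGroups.GLBlockParabolic
import Literature.RepresentationTheory.FiniteGroups.GLnCuspidalReduction
import Summits.MatrixMultiplication.MatrixMultiplication.Theorems.SubgroupIdentityDesigns.Negative.ParabolicSubgroup

/-!
# The index of a maximal parabolic: Gaussian binomials and the alternating `q`-identity

Supports stmt-MatrixMultiplication-14079 (route `LevelGradedCohnUmans`, crux `SubgroupIdentityDesigns`).
VALUE = theorem, NOT summit progress.  Pure combinatorics + one transport:

* `gauss q n c` — the Gaussian binomial `[n, c]_q`, DEFINED by the `q`-Pascal rule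
  `[n+1, c+1] = [n, c] + q^{c+1} [n, c+1]`; `gauss_mul_psi` — `[n, c]_q ψ_c ψ_{n-c} = ψ_n` with
  `ψ_n(q) = ∏_{i<n} (q^{i+1} − 1)` (`psi`); `pow_le_gauss` — `q^{c(n−c)} ≤ [n, c]_q`;
* `altSum_gauss` — the alternating identity `Σ_{c ≤ k} (−1)^{k−c} [n, c]_q q^{c(c−1)/2} = q^{k(k+1)/2} [n−1, k]_q`
  (`n ≥ 1`; exponents written as `Σ_{i<c} i`), whose cases `k = n` (Rothe / Cauchy `q`-binomial theorem
  at `z = −1`) and `k < n` give the degrees of the Steinberg and hook characters;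
* `index_parab` — **`[GL_a(F) : P^a_c] = [a, c]_q`**, `q = |F|`: the parabolic `ParabolicSubgroup.parab F a c`
  is the pull-back of `GLBlock.parabolic F (Fin c) (Fin (a−c))` along `GLn.blockEquiv`
  (`comap_parab_blockEquiv`), so `GLn.index_parabolic_mul` (`[G : P] ψ_c ψ_{a−c} = ψ_a`) applies.
References: Macdonald, *Symmetric Functions and Hall Polynomials* I.2 Ex. 3–4, IV.6; Stanley EC1 §1.7.
-/

set_option linter.dupNamespace false

noncomputable section

open scoped BigOperators Matrix Classical
open Literature.RepresentationTheory.FiniteGroups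

namespace Summit.MatrixMultiplication.MatrixMultiplication.Theorems.SubgroupIdentityDesigns.Negative
namespace ParabolicIndex

open ParabolicSubgroup

/-! ## `ψ_n(q)` and the Gaussian binomials -/

/-- `ψ_n(q) = ∏_{i<n} (q^{i+1} − 1)` (so `|GL_n(𝔽_q)| = q^{n(n−1)/2} ψ_n(q)`, `GLn.card_GL_fin`). -/
def psi (q n : ℕ) : ℕ := ∏ i ∈ Finset.range n, (q ^ (i + 1) - 1)

/-- `ψ_0 = 1`. -/
theorem psi_zero (q : ℕ) : psi q 0 = 1 := by simp [psi]

/-- `ψ_{n+1} = ψ_n (q^{n+1} − 1)`. -/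
theorem psi_succ (q n : ℕ) : psi q (n + 1) = psi q n * (q ^ (n + 1) - 1) := Finset.prod_range_succ _ _

/-- `ψ_n(q) > 0` for `q ≥ 2`. -/
theorem psi_pos {q : ℕ} (hq : 2 ≤ q) (n : ℕ) : 0 < psi q n :=
  Finset.prod_pos fun i _ => Nat.sub_pos_of_lt (Nat.one_lt_pow (by omega) (by omega))

/-- The Gaussian binomial `[n, c]_q`, by the `q`-Pascal recursion. -/
def gauss (q : ℕ) : ℕ → ℕ → ℕ
  | _, 0 => 1
  | 0, _ + 1 => 0
  | n + 1, c + 1 => gauss q n c + q ^ (c + 1) * gauss q n (c + 1)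

/-- `[n, 0] = 1`. -/
@[simp] theorem gauss_zero_right (q n : ℕ) : gauss q n 0 = 1 := by cases n <;> rfl

/-- `[0, c+1] = 0`. -/
@[simp] theorem gauss_zero_succ (q c : ℕ) : gauss q 0 (c + 1) = 0 := rfl

/-- The `q`-Pascal rule. -/
theorem gauss_succ_succ (q n c : ℕ) :
    gauss q (n + 1) (c + 1) = gauss q n c + q ^ (c + 1) * gauss q n (c + 1) := rfl

/-- `[n, c] = 0` for `c > n`. -/
theorem gauss_eq_zero_of_lt (q : ℕ) : ∀ {n c : ℕ}, n < c → gauss q n c = 0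
  | 0, c, h => by
    obtain ⟨c, rfl⟩ : ∃ c', c = c' + 1 := ⟨c - 1, by omega⟩
    rfl
  | n + 1, c, h => by
    obtain ⟨c, rfl⟩ : ∃ c', c = c' + 1 := ⟨c - 1, by omega⟩
    rw [gauss_succ_succ, gauss_eq_zero_of_lt q (show n < c by omega),
      gauss_eq_zero_of_lt q (show n < c + 1 by omega), mul_zero, add_zero]

/-- `[n, n] = 1`. -/
@[simp] theorem gauss_self (q : ℕ) : ∀ n : ℕ, gauss q n n = 1
  | 0 => rfl
  | n + 1 => by
    rw [gauss_succ_succ, gauss_self q n, gauss_eq_zero_of_lt q (Nat.lt_succ_self n), mul_zero, add_zero]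

/-- `(x − 1) + x (y − 1) = x y − 1` in `ℕ` for `x, y ≥ 1`. -/
theorem sub_one_add_mul_sub_one {x y : ℕ} (hx : 1 ≤ x) (hy : 1 ≤ y) :
    (x - 1) + x * (y - 1) = x * y - 1 := by
  have hxy : 1 ≤ x * y := Nat.mul_le_mul hx hy
  zify [hx, hy, hxy]
  ring

/-- **`[n, c]_q ψ_c ψ_{n−c} = ψ_n`** (`c ≤ n`, `q ≥ 1`). -/
theorem gauss_mul_psi {q : ℕ} (hq : 1 ≤ q) : ∀ (n c : ℕ), c ≤ n →
    gauss q n c * (psi q c * psi q (n - c)) = psi q n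
  | n, 0, _ => by simp [psi_zero]
  | 0, c + 1, h => absurd h (by omega)
  | n + 1, c + 1, h => by
    rcases Nat.lt_or_ge c n with hlt | hge
    · obtain ⟨d, rfl⟩ : ∃ d, n = c + 1 + d := ⟨n - (c + 1), by omega⟩
      have ih1 := gauss_mul_psi hq (c + 1 + d) c (by omega)
      have ih2 := gauss_mul_psi hq (c + 1 + d) (c + 1) (by omega)
      rw [show c + 1 + d - c = d + 1 by omega, psi_succ q d] at ih1
      rw [show c + 1 + d - (c + 1) = d by omega, psi_succ q c] at ih2
      rw [show c + 1 + d + 1 - (c + 1) = d + 1 by omega, gauss_succ_succ, psi_succ q c, psi_succ q d,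
        psi_succ q (c + 1 + d)]
      have key : (q ^ (c + 1) - 1) + q ^ (c + 1) * (q ^ (d + 1) - 1) = q ^ (c + 1 + d + 1) - 1 := by
        rw [sub_one_add_mul_sub_one (Nat.one_le_pow _ _ hq) (Nat.one_le_pow _ _ hq), ← pow_add,
          show c + 1 + (d + 1) = c + 1 + d + 1 by omega]
      calc (gauss q (c + 1 + d) c + q ^ (c + 1) * gauss q (c + 1 + d) (c + 1)) *
            (psi q c * (q ^ (c + 1) - 1) * (psi q d * (q ^ (d + 1) - 1)))
          = (q ^ (c + 1) - 1) * (gauss q (c + 1 + d) c * (psi q c * (psi q d * (q ^ (d + 1) - 1)))) +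
              q ^ (c + 1) * (q ^ (d + 1) - 1) *
                (gauss q (c + 1 + d) (c + 1) * (psi q c * (q ^ (c + 1) - 1) * psi q d)) := by ring
        _ = psi q (c + 1 + d) * ((q ^ (c + 1) - 1) + q ^ (c + 1) * (q ^ (d + 1) - 1)) := by
            rw [ih1, ih2]; ring
        _ = psi q (c + 1 + d) * (q ^ (c + 1 + d + 1) - 1) := by rw [key]
    · obtain rfl : c = n := le_antisymm (by omega) hge
      rw [Nat.sub_self, psi_zero, mul_one, gauss_self, one_mul]

/-- **`q^{c(n−c)} ≤ [n, c]_q`** (`c ≤ n`, `q ≥ 1`). -/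
theorem pow_le_gauss {q : ℕ} (hq : 1 ≤ q) : ∀ {n c : ℕ}, c ≤ n → q ^ (c * (n - c)) ≤ gauss q n c
  | n, 0, _ => by simp
  | 0, c + 1, h => absurd h (by omega)
  | n + 1, c + 1, h => by
    rcases Nat.lt_or_ge c n with hlt | hge
    · rw [gauss_succ_succ]
      calc q ^ ((c + 1) * (n + 1 - (c + 1)))
          = q ^ (c + 1) * q ^ ((c + 1) * (n - (c + 1))) := by
            rw [← pow_add]; congr 1
            obtain ⟨d, rfl⟩ : ∃ d, n = c + 1 + d := ⟨n - (c + 1), by omega⟩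
            rw [show c + 1 + d + 1 - (c + 1) = d + 1 by omega, show c + 1 + d - (c + 1) = d by omega]
            ring
        _ ≤ q ^ (c + 1) * gauss q n (c + 1) := Nat.mul_le_mul_left _ (pow_le_gauss hq (by omega))
        _ ≤ _ := Nat.le_add_left _ _
    · obtain rfl : c = n := le_antisymm (by omega) hge
      rw [Nat.sub_self, mul_zero, pow_zero, gauss_self]

/-- **The alternating `q`-identity**: for `n ≥ 1`,
`Σ_{c ≤ k} (−1)^{k−c} [n, c]_q q^{Σ_{i<c} i} = q^{Σ_{i ≤ k} i} [n−1, k]_q` (in any commutative ring). -/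
theorem altSum_gauss {R : Type} [CommRing R] (q : ℕ) {n : ℕ} (hn : 1 ≤ n) (k : ℕ) :
    ∑ c ∈ Finset.range (k + 1),
        (-1 : R) ^ (k - c) * ((gauss q n c * q ^ (∑ i ∈ Finset.range c, i) : ℕ) : R) =
      ((q ^ (∑ i ∈ Finset.range (k + 1), i) * gauss q (n - 1) k : ℕ) : R) := by
  obtain ⟨n, rfl⟩ : ∃ n', n = n' + 1 := ⟨n - 1, by omega⟩
  rw [Nat.add_sub_cancel]
  induction k with
  | zero => simp
  | succ k ih =>
    rw [Finset.sum_range_succ, Nat.sub_self, pow_zero, one_mul]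
    have hre : ∀ c ∈ Finset.range (k + 1),
        (-1 : R) ^ (k + 1 - c) * ((gauss q (n + 1) c * q ^ (∑ i ∈ Finset.range c, i) : ℕ) : R) =
          -((-1 : R) ^ (k - c) * ((gauss q (n + 1) c * q ^ (∑ i ∈ Finset.range c, i) : ℕ) : R)) := by
      intro c hc
      rw [show k + 1 - c = (k - c) + 1 by have := Finset.mem_range.mp hc; omega, pow_succ]
      ring
    rw [Finset.sum_congr rfl hre, Finset.sum_neg_distrib, ih, gauss_succ_succ,
      Finset.sum_range_succ (fun i => i) (k + 1)]
    push_cast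
    ring

/-! ## `[GL_a : P^a_c] = [a, c]_q` -/

variable {F : Type} [Field F] [Fintype F] [DecidableEq F] {a c : ℕ}

omit [Fintype F] [DecidableEq F] in
/-- Entries of `GLn.blockEquiv F h g`: `(g)_{e⁻¹ s, e⁻¹ t}` with `e = finSumFinEquiv.trans (finCongr h)`. -/
theorem blockEquiv_apply {d : ℕ} (h : c + d = a) (g : GL (Fin c ⊕ Fin d) F) (s t : Fin a) :
    ((GLn.blockEquiv F h g : GL (Fin a) F) : Matrix (Fin a) (Fin a) F) s t =
      (g : Matrix (Fin c ⊕ Fin d) (Fin c ⊕ Fin d) F) ((finSumFinEquiv.trans (finCongr h)).symm s)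
        ((finSumFinEquiv.trans (finCongr h)).symm t) := rfl

/-- **`P^a_c` is the pull-back of the block parabolic** `GLBlock.parabolic F (Fin c) (Fin (a − c))`. -/
theorem comap_parab_blockEquiv (hc : c ≤ a) :
    (parab F a c).comap (GLn.blockEquiv F (Nat.add_sub_cancel' hc)).toMonoidHom =
      GLBlock.parabolic F (Fin c) (Fin (a - c)) := by
  set e : Fin c ⊕ Fin (a - c) ≃ Fin a := finSumFinEquiv.trans (finCongr (Nat.add_sub_cancel' hc)) with he
  ext g
  rw [Subgroup.mem_comap, GLBlock.mem_parabolic_iff, MulEquiv.coe_toMonoidHom, mem_parab]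
  constructor
  · intro h
    ext i j
    have hij := h (e (Sum.inr i)) (e (Sum.inl j)) (by simp [e]) (by simp [e])
    rw [blockEquiv_apply, ← he, e.symm_apply_apply, e.symm_apply_apply] at hij
    exact hij
  · intro h s t ht hs
    have hs' : e.symm s = Sum.inr ⟨s - c, by omega⟩ := by
      rw [Equiv.symm_apply_eq]
      ext
      simp [e]
      omega
    have ht' : e.symm t = Sum.inl ⟨t, ht⟩ := by
      rw [Equiv.symm_apply_eq]
      ext
      simp [e]
    rw [blockEquiv_apply, ← he, hs', ht']
    exact congr_fun (congr_fun h ⟨(s : ℕ) - c, by omega⟩) ⟨t, ht⟩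

/-- `[GL_a : P^a_c] = [GL(Fin c ⊕ Fin (a−c)) : P_{c, a−c}]`. -/
theorem index_parab_eq (hc : c ≤ a) :
    (parab F a c).index = (GLBlock.parabolic F (Fin c) (Fin (a - c))).index := by
  rw [← comap_parab_blockEquiv hc, Subgroup.index_comap_of_surjective]
  exact (GLn.blockEquiv F (Nat.add_sub_cancel' hc)).surjective

/-- `[GL_a : P^a_c] ψ_c ψ_{a−c} = ψ_a`. -/
theorem index_parab_mul_psi (hc : c ≤ a) :
    (parab F a c).index * (psi (Fintype.card F) c * psi (Fintype.card F) (a - c)) =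
      psi (Fintype.card F) a := by
  rw [index_parab_eq hc]
  have h := GLn.index_parabolic_mul F c (a - c)
  rw [Nat.add_sub_cancel' hc] at h
  exact h

/-- **`[GL_a(F) : P^a_c] = [a, c]_q`**, `q = |F|`. -/
theorem index_parab (hc : c ≤ a) : (parab F a c).index = gauss (Fintype.card F) a c := by
  have hq : 2 ≤ Fintype.card F := Fintype.one_lt_card
  have h1 := index_parab_mul_psi (F := F) hc
  rw [← gauss_mul_psi (q := Fintype.card F) (by omega) a c hc] at h1
  exact Nat.eq_of_mul_eq_mul_right (Nat.mul_pos (psi_pos hq c) (psi_pos hq (a - c))) h1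

/-- `|GL_a / P^a_c| = [a, c]_q`. -/
theorem card_quotient_parab (hc : c ≤ a) :
    Nat.card (GL (Fin a) F ⧸ parab F a c) = gauss (Fintype.card F) a c := by
  rw [← Subgroup.index_eq_card, index_parab hc]

end ParabolicIndex
end Summit.MatrixMultiplication.MatrixMultiplication.Theorems.SubgroupIdentityDesigns.Negative
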